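import Literature.RingTheory.FormalGroups.PadicLogTypeSeriesDivision
import HarnessLib

/-!
# The Legendre determinant of two `[p]`-division towers is a `φ`-eigenvector with eigenvalue `p`

Topic `Literature/RingTheory/FormalGroups`; namespace `Literature.RingTheory.FormalGroups.PadicLogSeries`. THEOREMS ONLY.
Corollary of `PadicLogTypeSeriesDivision.frobenius_honda_eq_zero_of_tower`: if `X, X′` satisfy `Φ²X − a·ΦX + p·X = 0` then
`D = X·ΦX′ − ΦX·X′` has `ΦD = p·D` (`frob_det_eq_mul_det`, pure algebra: det of the companion matrix), hence ★★
`frob_det_logSum_eq_p_mul`: for the bottom periods `L, L′` of two `[p]`-division towers with Frobenius lifts,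
**`φ(L·φL′ − φL·L′) = p·(L·φL′ − φL·L′)`** in `B^_(p)`. This is the `φ`-eigen-property of the Legendre resolution with
`Pη := φ∘Pω` — the input of Fontaine's lemma `(A_max)^{φ=p} ∩ ker θ = ℤ_p·t` in the φ-road to (K₂) of line `kato_lever`
(crux K★ `stmt-BirchSwinnertonDyer-22226`, memo `Lines/kato-lever-K2-phi-road.md` §2). Infrastructure only: BSD / K★ are not proved by any of this.

## References
* T. Honda, *On the theory of commutative formal groups*, J. Math. Soc. Japan 22 (1970), Thm. 2 (p. 223). [Honda1970]
* J.-M. Fontaine, Y. Ouyang, *Theory of p-adic Galois representations*, §6.1. [FontaineOuyang2022]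
-/

noncomputable section

namespace Literature.RingTheory.FormalGroups

namespace PadicLogSeries

open Literature.AlgebraicGeometry.Resolution

variable {p : ℕ} [hp : Fact p.Prime]

universe u

variable {B : Type u} [CommRing B]

/-! ## The Legendre determinant of two solutions of `φ²X − a·φX + p·X = 0` is a `φ`-eigenvector with eigenvalue `p` -/

omit hp in
/-- ★★ **`φD = p·D` for the Legendre determinant.** In any commutative ring `C` with an endomorphism `Φ`, if `X, X'` satisfy the
Dieudonné–Honda relation `Φ²X − a·ΦX + p·X = 0` (as delivered by `frobenius_honda_eq_zero_of_tower` for the periods of two points of the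
universal cover, `C = B^_(p)`), then `D := X·ΦX′ − ΦX·X′` satisfies **`ΦD = p·D`**: the determinant of the companion matrix
`[[0, −p], [1, a]]` is `p` (no hypothesis on `Φ a`, `Φ p` is needed: they cancel). With `X = L_ũ`, `X′ = L_a` this is the `φ`-eigen-property of the Legendre resolution `x̃(a)` of the
φ-road (Fontaine: `(B⁺_crys)^{φ=p} = ℚ_p ⊗ log[1+𝔪♭]`). [cite: Honda1970, Thm. 2 (p. 223)] [cite: FontaineOuyang2022, §6.1] -/
theorem frob_det_eq_mul_det {C : Type*} [CommRing C] (Φ : C →+* C) {a q : C} {X X' : C}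
    (hX : Φ (Φ X) - a * Φ X + q * X = 0) (hX' : Φ (Φ X') - a * Φ X' + q * X' = 0) :
    Φ (X * Φ X' - Φ X * X') = q * (X * Φ X' - Φ X * X') := by
  have e1 : Φ (Φ X) = a * Φ X - q * X := by linear_combination hX
  have e2 : Φ (Φ X') = a * Φ X' - q * X' := by linear_combination hX'
  rw [map_sub, map_mul, map_mul, e1, e2]
  ring

/-- ★★ **The `φ`-road's determinant in `B^_(p)`**: for two `[p]`-division towers `x, x′` as in `frobenius_honda_eq_zero_of_tower`
(same numerators `b`, same Honda type `p − aT + T²`, same Frobenius lift `φ` fixing `ι(ℤ_p)`), the Legendre determinant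
`D = Λ(x 0)·φΛ(x′ 0) − φΛ(x 0)·Λ(x′ 0)` of the bottom periods satisfies **`φD = p·D`** in `B^_(p)`.
[cite: Honda1970, Thm. 2 (p. 223)] [cite: FontaineOuyang2022, §6.1] -/
theorem frob_det_logSum_eq_p_mul [IsDomain B] [CharZero B] (ι : ℤ_[p] →+* B) (b : ℕ → ℤ_[p]) (φ : B →+* B)
    (hφι : φ.comp ι = ι) (a : ℤ_[p]) (e : ℕ → ℤ_[p])
    (he : ∀ m : ℕ, m ≠ 0 → (m : ℤ_[p]) * e m =
      b m - (if p ∣ m then a * b (m / p) else 0) + (if p ^ 2 ∣ m then (p : ℤ_[p]) * b (m / p ^ 2) else 0))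
    (x z h x' z' h' : ℕ → B) (N N' : ℕ → ℕ) (hN0 : 1 ≤ N 0) (hN'0 : 1 ≤ N' 0) (hNmono : Monotone N) (hN'mono : Monotone N')
    (hxz : ∀ n, x n ^ N n = (p : B) * z n) (hxz' : ∀ n, x' n ^ N' n = (p : B) * z' n)
    (hφx : ∀ n, φ (x n) = x n ^ p + (p : B) * h n) (hφx' : ∀ n, φ (x' n) = x' n ^ p + (p : B) * h' n)
    (hdiv : ∀ n, logSum ι b (N (n + 1)) (x n) (z n * x n ^ (N (n + 1) - N n)) =
      AdicCompletion.of (Ideal.span {(p : B)}) B (p : B) * logSum ι b (N (n + 1)) (x (n + 1)) (z (n + 1)))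
    (hdiv' : ∀ n, logSum ι b (N' (n + 1)) (x' n) (z' n * x' n ^ (N' (n + 1) - N' n)) =
      AdicCompletion.of (Ideal.span {(p : B)}) B (p : B) * logSum ι b (N' (n + 1)) (x' (n + 1)) (z' (n + 1))) :
    let Φ := adicCompletionMap _ _ φ (map_span_natCast_le_self φ)
    let L := logSum ι b (N 0) (x 0) (z 0)
    let L' := logSum ι b (N' 0) (x' 0) (z' 0)
    Φ (L * Φ L' - Φ L * L') = (p : AdicCompletion (Ideal.span {(p : B)}) B) * (L * Φ L' - Φ L * L') := by
  intro Φ L L'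
  have hR := frobenius_honda_eq_zero_of_tower ι b φ hφι a e he x z h N hN0 hNmono hxz hφx hdiv
  have hR' := frobenius_honda_eq_zero_of_tower ι b φ hφι a e he x' z' h' N' hN'0 hN'mono hxz' hφx' hdiv'
  have hofp : AdicCompletion.of (Ideal.span {(p : B)}) B (p : B) = (p : AdicCompletion (Ideal.span {(p : B)}) B) :=
    map_natCast (algebraMap B (AdicCompletion (Ideal.span {(p : B)}) B)) p
  rw [hofp] at hR hR'
  exact frob_det_eq_mul_det Φ hR hR'

end PadicLogSeries

end Literature.RingTheory.FormalGroups

end
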